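import Summits.Ventures.PercRepro.C041ZoneAdm

/-!
# Deleted vertices, the reach of `K₀`, and the red cluster of a tail-free colouring — facts (F1) and (F5) of
C-041.md §11 on a single cube state (p6, gen 26)

Setting of `C041ZoneAdm`.  For a cube state `S` of `O` the DELETED vertices of side `a` are the blue cluster of `a`
(`cluster Sᶜ a`, the set `D_a` avoided by `ρ_a`); `K₀ = BareReach a b c O` is the red bare cluster of the probe in
`O`, and `K(S) = BareReach a b c S` the one in `S`.

* `mem_cluster_compl_iff_attached`: in an admissible state a non-terminal is deleted on side `a` iff its sub-zone is
  attached to `a` (the blue cluster of a terminal is read per sub-zone);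
* **(F5)** `rhoA_of_forall_notMem` / `exists_deleted_of_not_rhoA`: every vertex of `K₀` is reached from the probe
  avoiding `D_a` as soon as no vertex of `K₀` is deleted (the red `O`-walk stays in `K₀`), so `¬ρ_a(u)` for
  `u ∈ K₀` forces a deleted vertex of `K₀`; `exists_attached_of_mem_bareReach_of_mem_cluster`: a deleted vertex of `K₀`
  has its sub-zone attached to `a` — it is an anchor of a terminal-adjacent zone;
* **(F1), global part** `TailFree`, `mem_bareReach_iff_of_tailFree`: for a TAIL-FREE colouring (every red bare
  `O`-edge has both ends in `K₀`) the red cluster `K(S)` of a cube state is `K₀` together with the vertices reached from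
  `K₀` along OPENED edges (`OpenedAdj`: blue in `O`, red in `S`), and an opened walk stays inside one zone of `O`
  (`blueBareConn_of_openedWalk`).

The per-zone reading (`K_Z`, `REACH_Z`) needs the zone split and is not typed here.
-/

namespace PercRepro

namespace MultiGraph

open Finset

variable {V E : Type*} {G : MultiGraph V E}

section Deleted

variable (a b c : V)

/-- **Deleted vertices are read per sub-zone**: in an admissible state a non-terminal `v` lies in the blue cluster of
the terminal `a` iff its sub-zone is attached to `a`. -/
theorem mem_cluster_compl_iff_attached {S : Config E} (hadm : ¬ G.Conn Sᶜ a b) {v : V}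
    (hv : v ≠ a ∧ v ≠ b) : v ∈ G.cluster Sᶜ a ↔ G.Attached a b S v a := by
  rw [mem_cluster]
  constructor
  · intro h
    rcases blueBareConn_or_attached_of_conn_compl hv h.symm with h' | ⟨t, ht, hatt, hconn⟩
    · exact absurd rfl (ne_terminal_of_blueBareConn h' hv).1
    · rcases ht with rfl | rfl
      · exact hatt
      · exact absurd hconn.symm hadm
  · intro h
    exact (conn_compl_of_attached h).symm

/-- The symmetric statement for side `b`. -/
theorem mem_cluster_compl_iff_attached' {S : Config E} (hadm : ¬ G.Conn Sᶜ a b) {v : V}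
    (hv : v ≠ a ∧ v ≠ b) : v ∈ G.cluster Sᶜ b ↔ G.Attached a b S v b := by
  rw [mem_cluster]
  constructor
  · intro h
    rcases blueBareConn_or_attached_of_conn_compl hv h.symm with h' | ⟨t, ht, hatt, hconn⟩
    · exact absurd rfl (ne_terminal_of_blueBareConn h' hv).2
    · rcases ht with rfl | rfl
      · exact absurd hconn hadm
      · exact hatt
  · intro h
    exact (conn_compl_of_attached h).symm

/-- The red bare edges of `O` are red in every cube state, so a red bare `O`-walk is a red bare `S`-walk. -/
theorem bareAdj_of_bareAdj_O {O S : Config E} (hS : ∀ e, G.Bare a b e → O e = true → S e = true) {u v : V}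
    (h : G.BareAdj a b O u v) : G.BareAdj a b S u v := by
  obtain ⟨e, he, hO, hj⟩ := h
  exact ⟨e, he, hS e he hO, hj⟩

/-- `K₀ ⊆ K(S)` for a cube state. -/
theorem bareReach_O_subset {O S : Config E} (hS : ∀ e, G.Bare a b e → O e = true → S e = true) {u : V}
    (hu : u ∈ G.BareReach a b c O) : u ∈ G.BareReach a b c S := by
  induction hu with
  | refl => exact Relation.ReflTransGen.refl
  | tail _ hxy ih => exact ih.tail (bareAdj_of_bareAdj_O a b hS hxy)

/-- **(F5), the reach of `K₀`**: if no vertex of `K₀` is deleted on side `a`, every vertex of `K₀` is reached from the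
probe by a red walk avoiding `D_a` — the red bare `O`-walk itself. -/
theorem rhoA_of_forall_notMem {O S : Config E} (hS : ∀ e, G.Bare a b e → O e = true → S e = true)
    (hK : ∀ w ∈ G.BareReach a b c O, w ∉ G.cluster Sᶜ a) {u : V} (hu : u ∈ G.BareReach a b c O) :
    G.RhoA a c S u := by
  refine ⟨hK c Relation.ReflTransGen.refl, ?_⟩
  induction hu with
  | refl => exact Relation.ReflTransGen.refl
  | @tail x y hcx hxy ih =>
    exact ih.tail ⟨(bareAdj_of_bareAdj_O a b hS hxy).openAdj, hK y (hcx.tail hxy)⟩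

/-- **(F5), contrapositive**: `¬ρ_a(u)` for a vertex `u` of `K₀` forces a deleted vertex of `K₀`. -/
theorem exists_deleted_of_not_rhoA {O S : Config E} (hS : ∀ e, G.Bare a b e → O e = true → S e = true) {u : V}
    (hu : u ∈ G.BareReach a b c O) (h : ¬ G.RhoA a c S u) : ∃ w ∈ G.BareReach a b c O, w ∈ G.cluster Sᶜ a := by
  by_contra hne
  apply h
  refine rhoA_of_forall_notMem a b c hS (fun w hw hw' => hne ⟨w, hw, hw'⟩) hu

/-- A deleted vertex of `K₀` (side `a`) has its sub-zone attached to `a`: it is an anchor of a terminal-adjacent zone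
(the attachment's vertex carries a terminal edge and lies in the sub-zone, hence in the zone of `O`). -/
theorem exists_attached_of_mem_bareReach_of_mem_cluster {O S : Config E} (hc : c ≠ a ∧ c ≠ b)
    (hadm : ¬ G.Conn Sᶜ a b) {w : V} (hw : w ∈ G.BareReach a b c O) (hdel : w ∈ G.cluster Sᶜ a) :
    G.Attached a b S w a := by
  have hw' : w ≠ a ∧ w ≠ b := by
    induction hw with
    | refl => exact hc
    | tail _ hbc _ =>
      obtain ⟨e, he, _, hj⟩ := hbc
      exact (ne_of_bare_joins he hj).2
  exact (mem_cluster_compl_iff_attached a b hadm hw').1 hdel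

end Deleted

section TailFree

variable (G) (a b c : V)

/-- A TAIL-FREE colouring: every red bare edge of `O` has both ends in `K₀` (C-041.md §11). -/
def TailFree (O : Config E) : Prop :=
  ∀ e, G.Bare a b e → O e = true → G.fst e ∈ G.BareReach a b c O ∧ G.snd e ∈ G.BareReach a b c O

/-- An OPENED edge of the state `S` over `O`: a bare edge blue in `O` and red in `S` (an edge of `X`). -/
def OpenedAdj (O S : Config E) (u v : V) : Prop :=
  ∃ e, G.Bare a b e ∧ O e = false ∧ S e = true ∧ G.Joins e u v

variable {G a b c}

/-- An opened walk stays inside one zone of `O` (opened edges are blue bare edges of `O`). -/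
theorem blueBareConn_of_openedWalk {O S : Config E} {u v : V}
    (h : Relation.ReflTransGen (G.OpenedAdj a b O S) u v) : G.BlueBareConn a b O u v := by
  induction h with
  | refl => exact BlueBareConn.refl a b O u
  | tail _ hbc ih =>
    obtain ⟨e, he, hO, _, hj⟩ := hbc
    exact ih.tail ⟨e, he, hO, hj⟩

/-- An opened walk is a red bare walk of `S`. -/
theorem reflTransGen_bareAdj_of_openedWalk {O S : Config E} {u v : V}
    (h : Relation.ReflTransGen (G.OpenedAdj a b O S) u v) : Relation.ReflTransGen (G.BareAdj a b S) u v := by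
  induction h with
  | refl => exact Relation.ReflTransGen.refl
  | tail _ hbc ih =>
    obtain ⟨e, he, _, hSe, hj⟩ := hbc
    exact ih.tail ⟨e, he, hSe, hj⟩

/-- **(F1), global part**: for a tail-free `O` and a cube state `S`, the red cluster `K(S)` of the probe consists of
`K₀` and the vertices reached from a vertex of `K₀` (an anchor) along opened edges. -/
theorem mem_bareReach_iff_of_tailFree {O S : Config E} (hO : G.TailFree a b c O)
    (hS : ∀ e, G.Bare a b e → O e = true → S e = true) {v : V} :
    v ∈ G.BareReach a b c S ↔
      v ∈ G.BareReach a b c O ∨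
        ∃ w ∈ G.BareReach a b c O, Relation.ReflTransGen (G.OpenedAdj a b O S) w v := by
  constructor
  · intro hv
    induction hv with
    | refl => exact Or.inl Relation.ReflTransGen.refl
    | @tail x y _ hxy ih =>
      obtain ⟨e, he, hSe, hj⟩ := hxy
      by_cases hOe : O e = true
      · left
        rcases hj with ⟨_, h2⟩ | ⟨h1, _⟩
        · exact h2 ▸ (hO e he hOe).2
        · exact h1 ▸ (hO e he hOe).1
      · have hOe' : O e = false := by
          cases h : O e
          · rfl
          · exact absurd h hOe
        rcases ih with hx | ⟨w, hw, hwx⟩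
        · exact Or.inr ⟨x, hx, Relation.ReflTransGen.single ⟨e, he, hOe', hSe, hj⟩⟩
        · exact Or.inr ⟨w, hw, hwx.tail ⟨e, he, hOe', hSe, hj⟩⟩
  · rintro (hv | ⟨w, hw, hwv⟩)
    · exact bareReach_O_subset a b c hS hv
    · exact Relation.ReflTransGen.trans (bareReach_O_subset a b c hS hw) (reflTransGen_bareAdj_of_openedWalk hwv)

end TailFree

end MultiGraph

end PercRepro
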